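/-
Copyright (c) 2026 the pub-hodgecm-mathlib formalisation cell (harness21).  Prover seat hodgecm-mathlib-K2Liu-p12 (g2): Track B «K2-LIT»,
#184♮ = hLiu418 = stmt-HodgeConjecture-24832; Road Φ of socket #41, organ Φ4-EXACT (LEAD F0P6-plan ruling «M-157p»), method «E-det», file E3b:
HERMITIAN COORDINATES ON THE SKEW LATTICE `S` (every `T`-skew `t` is `T⁻¹(ε • H)`), balls ∕ determinant levels ∕ the pairing letters in them.  THEOREMS ONLY (no `def`, no `instance`, no `notation`, no named-fact hypothesis, no `sorry`).
-/
import Summits.HodgeConjecture.HodgeConjecture.Theorems.K2LiuSkewLatticeInertCoordinates          -- ★ E3a: `ι a + ι b δ̂` coordinates, `skew_coords`, `mball_coords`, `det_coords`, `tau_trace_coords`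
import HarnessLib

/-!
# Crux `HLiu418`, Road Φ, organ Φ4-EXACT (E-det), file E3b: HERMITIAN COORDINATES ON THE SKEW LATTICE

Cell `hodgecm-mathlib`, crux item hLiu418 = `stmt-HodgeConjecture-24832` (helper lane, count-neutral), route of record `HCCMUnconditional`;
squad K2 ∕ K2Liu, socket #41, Road Φ, organ Φ4-EXACT (method memo `K2/K2Liu-p12/g2/CENSUS-PHI4-EXACT-Method.K2Liu-p12-g2.md`).
Frame of ★ `K2LiuGoodPlaceWhittakerBound` with `n = 2`: `S = {t ∈ M₂(E ⊗ F_v) : σ(t)ᵀ T + T t = 0}`, `T = gramS`, `R = E ⊗ F_v = ι(F_v) ⊕ ι(F_v) δ̂`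
(★ `quadraticLocalEquiv`), `τ` the trace-type functional (`ι(τ r) = r + σ r`), `|2|_v = 1`.

THE COORDINATES [Shimura1997, §13.5; KudlaRallis1994, §2].  For an anti-invariant unit `ε` (`σ ε = −ε`) every `T`-skew `t` is
`X(a, b, z₁, z₂) := T⁻¹(ε • H)`, `H = (ι a, z; σ z, ι b)`, `z = ι z₁ + ι z₂ δ̂`, `(a, b, z₁, z₂) ∈ F_v⁴` (§1 `exists_coords`: `H := ε⁻¹ T t` is Hermitian and
`σ`-fixed scalars are `ι(τ∕2)`); the family is additive (`coordMatrix_add`, `coordMatrix_neg`); with `T` unimodular, `ε` a unit and `{1, δ̂}` an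
integral basis, `X ∈ B(m) ⟹ a, b, z₁, z₂ ∈ 𝔭_v^m` (`coords_mem_of_mball`; `⟸` is ★ E3a `mball_coords`) and `X ∈ D(m) ⟺ ab − (z₁² − dd z₂²) ∈ 𝔭_v^m`
(`det_mball_iff`); the Whittaker integrand `ψ(−τ tr(β ·))` (`ψ` of conductor `0`, `β` integral) is constant on `B(0)`-cosets
(`addChar_neg_tau_trace_add`).  §2: for `T`-skew unimodular `β`, `ε⁻¹ β T⁻¹ = (ι p, u; σ u, ι r)` with `p, r, u₁, u₂ ∈ 𝒪_v`,
`τ tr(β X(a,b,z₁,z₂)) = 2e·(p a + r b + 2(u₁ z₁ − dd u₂ z₂))` (`exists_pairing_letters`, ★ E3a `tau_trace_coords`) and `|p r − (u₁² − dd u₂²)|_w = 1`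
(`valued_toPlace_pairing_det`).  These are the letters of the inert residue-quadric value `I(1,1) = +q_v μ(B(0))` (file E3c).
HONEST LABEL.  Helper lemmas, count-neutral; `HC_CM` is proved only modulo the 7 printed citations (2 remaining named inputs:
hLiu418 = `stmt-HodgeConjecture-24832`, h413 = `stmt-HodgeConjecture-24833`) until rung 0 closes.

## References
* [Shimura1997] G. Shimura, *Euler Products and Eisenstein Series*, CBMS 93 (1997), §13.5–13.6.
* [KudlaRallis1994] S. Kudla, S. Rallis, *A regularized Siegel–Weil formula: the first term identity*, Ann. of Math. 140 (1994), §2.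
* [CasselsFrohlichANT1967] J. W. S. Cassels, A. Fröhlich (eds.), *Algebraic Number Theory* (1967), Ch. II §10, Ch. VII §1.1.   * [Tate1950] J. Tate, thesis, §2.2.
-/

set_option autoImplicit false
set_option linter.dupNamespace false -- the mandated namespace repeats `HodgeConjecture.HodgeConjecture`

noncomputable section

open scoped Matrix Valued
open NumberField IsDedekindDomain Matrix MeasureTheory
open Literature.NumberTheory.Automorphic Literature.NumberTheory.Automorphic.UnitaryGroup
open Literature.NumberTheory.GelbartRogawski1991.UnitaryDualPair.LocalSplitting
open Summit.HodgeConjecture.HodgeConjecture.Cruxes.HLiu418.K2LiuLocalRingValuationBalls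
open Summit.HodgeConjecture.HodgeConjecture.Cruxes.HLiu418.K2LiuWhittakerContentStrata
open Summit.HodgeConjecture.HodgeConjecture.Cruxes.HLiu418.K2LiuWhittakerCharacterMoves
open Summit.HodgeConjecture.HodgeConjecture.Cruxes.HLiu418.K2LiuSkewPairingNondegeneracy
open Summit.HodgeConjecture.HodgeConjecture.Cruxes.HLiu418.K2LiuResidueCharacterCosets
open Summit.HodgeConjecture.HodgeConjecture.Cruxes.HLiu418.K2LiuSkewLatticeInertCoordinates
open Summit.HodgeConjecture.HodgeConjecture.Cruxes.H413.K2E1IntertwiningLocalFactorU3Height (quadraticLocalEquiv_mul_conjLocal)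

namespace Summit.HodgeConjecture.HodgeConjecture.Cruxes.HLiu418.K2LiuSkewLatticeHermitianCoordinates

variable (F : Type) [Field F] [NumberField F] (E : Type) [Field E] [NumberField E] [Algebra F E]
  [Algebra.IsQuadraticExtension F E] (c : E ≃ₐ[F] E) {δ : E} (hcδ : c δ = -δ) (hδ : δ ≠ 0) {dd : F} (hd : δ * δ = algebraMap F E dd)
  (v : HeightOneSpectrum (𝓞 F)) {T₀ : Matrix (Fin 2) (Fin 2) F} {π : v.adicCompletion F} (hπ : Valued.v π = WithZero.exp (-1 : ℤ))
  {τ : LocalRing E v → v.adicCompletion F}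

/-! ## §0 Unimodular matrices have unit determinant at every place -/

include hπ in
omit [Algebra.IsQuadraticExtension F E] in
/-- if `X, Y` are integral with `X Y = 1` then `|det X|_w = 1` at every `w ∣ v`. [cite: CasselsFrohlichANT1967, Ch. II §10] -/
theorem valued_det_eq_one_of_mul_eq_one {X Y : Matrix (Fin 2) (Fin 2) (LocalRing E v)}
    (hX : ∀ i j (w : PlacesOver E v), Valued.v (X i j w) ≤ Valued.v (toPlace v w π) ^ (0 : ℤ))
    (hY : ∀ i j (w : PlacesOver E v), Valued.v (Y i j w) ≤ Valued.v (toPlace v w π) ^ (0 : ℤ)) (hXY : X * Y = 1) (w : PlacesOver E v) :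
    Valued.v (X.det w) = 1 := by
  have h1 : Valued.v (X.det w) ≤ 1 := by have h := det_mem_ball_two F E v hπ hX w; rwa [add_zero, zpow_zero] at h
  have h2 : Valued.v (Y.det w) ≤ 1 := by have h := det_mem_ball_two F E v hπ hY w; rwa [add_zero, zpow_zero] at h
  have hprod : Valued.v (X.det w) * Valued.v (Y.det w) = 1 := by
    rw [← map_mul, ← Pi.mul_apply, ← Matrix.det_mul, hXY, Matrix.det_one, Pi.one_apply, map_one]
  refine le_antisymm h1 ?_
  calc (1 : WithZero (Multiplicative ℤ)) = Valued.v (X.det w) * Valued.v (Y.det w) := hprod.symm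
    _ ≤ Valued.v (X.det w) * 1 := mul_le_mul' le_rfl h2
    _ = Valued.v (X.det w) := mul_one _

/-! ## §1 Every `T`-skew matrix is `T⁻¹(ε • H)` with `H` Hermitian; balls and determinant levels in the coordinates `(a, b, z₁, z₂)` -/

/-- **Hermitian coordinates**: for `T`-skew `t` and an anti-invariant unit `ε`, `t = T⁻¹(ε • H)` with `H = (ι a, ι z₁ + ι z₂ δ̂; σ(…), ι b)`
(`H := ε⁻¹ T t` satisfies `σ(H) = Hᵀ`; `σ`-fixed scalars are `ι(τ∕2)`). [cite: Shimura1997, §13.5] -/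
theorem exists_coords (hT₀ : T₀.IsSymm) (hT₀d : IsUnit T₀.det)
    (hτ : ∀ r, toLocalRing E v (τ r) = r + conjLocal E c v r) (h2F : Valued.v (2 : v.adicCompletion F) = 1)
    (εu : (LocalRing E v)ˣ) (hεσ : conjLocal E c v (εu : LocalRing E v) = -(εu : LocalRing E v))
    {t : Matrix (Fin 2) (Fin 2) (LocalRing E v)} (ht : (t.map (conjLocal E c v))ᵀ * gramS F E v 2 T₀ + gramS F E v 2 T₀ * t = 0) :
    ∃ a b z₁ z₂ : v.adicCompletion F, t = (gramS F E v 2 T₀)⁻¹ * ((εu : LocalRing E v) •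
      !![toLocalRing E v a, quadraticLocalEquiv E v c hcδ hδ (z₁, z₂); conjLocal E c v (quadraticLocalEquiv E v c hcδ hδ (z₁, z₂)), toLocalRing E v b]) := by
  set T := gramS F E v 2 T₀ with hTdef
  have hT : IsUnit T.det := isUnit_det_gramS' F E v 2 hT₀d
  have hTt : Tᵀ = T := gramS_transpose F E v 2 hT₀
  have hTσ : T.map (conjLocal E c v) = T := gramS_map_conj F E c v 2
  have h20 : (2 : v.adicCompletion F) ≠ 0 := fun h0 => by rw [h0, map_zero] at h2F; exact zero_ne_one h2F
  have hfix : ∀ x : LocalRing E v, conjLocal E c v x = x → x = toLocalRing E v (2⁻¹ * τ x) := fun x hx => by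
    have h1 : toLocalRing E v (τ x) = 2 * x := by rw [hτ, hx, two_mul]
    rw [map_mul, h1, ← mul_assoc, show toLocalRing E v 2⁻¹ * 2 = 1 by rw [← map_ofNat (toLocalRing E v) 2, ← map_mul, inv_mul_cancel₀ h20, map_one],
      one_mul]
  have hσεinv : conjLocal E c v (↑εu⁻¹ : LocalRing E v) = -(↑εu⁻¹ : LocalRing E v) := by
    have h1 : conjLocal E c v (↑εu⁻¹ : LocalRing E v) * (-(εu : LocalRing E v)) = 1 := by
      rw [← hεσ, ← _root_.map_mul, Units.inv_mul, map_one]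
    calc conjLocal E c v (↑εu⁻¹ : LocalRing E v)
        = conjLocal E c v (↑εu⁻¹ : LocalRing E v) * (-(εu : LocalRing E v) * -(↑εu⁻¹ : LocalRing E v)) := by
          rw [neg_mul_neg, Units.mul_inv, mul_one]
      _ = -(↑εu⁻¹ : LocalRing E v) := by rw [← mul_assoc, h1, one_mul]
  -- `H := ε⁻¹ • (T t)` is Hermitian
  set H : Matrix (Fin 2) (Fin 2) (LocalRing E v) := (↑εu⁻¹ : LocalRing E v) • (T * t) with hHdef
  have hTt' : (T * t).map (conjLocal E c v) = -(T * t)ᵀ := by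
    have h1 := congrArg Matrix.transpose ht
    rw [Matrix.transpose_add, Matrix.transpose_mul, Matrix.transpose_mul, Matrix.transpose_transpose, hTt,
      Matrix.transpose_zero] at h1
    rw [Matrix.map_mul, hTσ, Matrix.transpose_mul, hTt]
    exact eq_neg_of_add_eq_zero_left h1
  have hHσ : H.map (conjLocal E c v) = Hᵀ := by
    have hsm : H.map (conjLocal E c v) = conjLocal E c v ↑εu⁻¹ • ((T * t).map (conjLocal E c v)) := by
      ext i j; simp only [hHdef, Matrix.map_apply, Matrix.smul_apply, smul_eq_mul, _root_.map_mul]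
    rw [hsm, hσεinv, hTt', smul_neg, neg_smul, neg_neg, hHdef, Matrix.transpose_smul]
  have h00 : conjLocal E c v (H 0 0) = H 0 0 := by
    have h := congrFun (congrFun hHσ 0) 0; rwa [Matrix.map_apply, Matrix.transpose_apply] at h
  have h11 : conjLocal E c v (H 1 1) = H 1 1 := by
    have h := congrFun (congrFun hHσ 1) 1; rwa [Matrix.map_apply, Matrix.transpose_apply] at h
  have h10 : H 1 0 = conjLocal E c v (H 0 1) := by
    have h := congrFun (congrFun hHσ 0) 1; rw [Matrix.map_apply, Matrix.transpose_apply] at h; exact h.symm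
  obtain ⟨⟨z₁, z₂⟩, hz⟩ : ∃ z : v.adicCompletion F × v.adicCompletion F, quadraticLocalEquiv E v c hcδ hδ z = H 0 1 :=
    ⟨_, (quadraticLocalEquiv E v c hcδ hδ).apply_symm_apply _⟩
  refine ⟨2⁻¹ * τ (H 0 0), 2⁻¹ * τ (H 1 1), z₁, z₂, ?_⟩
  have hεH : (εu : LocalRing E v) • H = T * t := by rw [hHdef, smul_smul, Units.mul_inv, one_smul]
  rw [hz, ← h10, ← hfix _ h00, ← hfix _ h11, ← Matrix.eta_fin_two H, hεH, Matrix.nonsing_inv_mul_cancel_left _ _ hT]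

include hd hπ in
/-- **balls in coordinates (⇒)**: `T⁻¹(ε • H(a, b, z₁, z₂)) ∈ B(m) ⇒ a, b, z₁, z₂ ∈ 𝔭_v^m` (`T` integral, `ε` a unit, `{1, δ̂}` an integral basis:
`|2|_v = |dd|_v = 1`, `|δ̂|_w ≤ 1`). [cite: CasselsFrohlichANT1967, Ch. II §10] -/
theorem coords_mem_of_mball (hT₀d : IsUnit T₀.det)
    (hτ : ∀ r, toLocalRing E v (τ r) = r + conjLocal E c v r) (hτadd : ∀ r s, τ (r + s) = τ r + τ s)
    (hτs : ∀ (z : v.adicCompletion F) (r : LocalRing E v), τ (toLocalRing E v z * r) = z * τ r)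
    (h2F : Valued.v (2 : v.adicCompletion F) = 1) (hddv : Valued.v (dd : v.adicCompletion F) = 1)
    (hδw : ∀ w : PlacesOver E v, Valued.v (algebraMap E (LocalRing E v) δ w) ≤ Valued.v (toPlace v w π) ^ (0 : ℤ))
    (hTb : ∀ i j (w : PlacesOver E v), Valued.v (gramS F E v 2 T₀ i j w) ≤ Valued.v (toPlace v w π) ^ (0 : ℤ))
    (εu : (LocalRing E v)ˣ) (hεinv : ∀ w : PlacesOver E v, Valued.v ((↑εu⁻¹ : LocalRing E v) w) ≤ Valued.v (toPlace v w π) ^ (0 : ℤ))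
    {m : ℤ} {a b z₁ z₂ : v.adicCompletion F}
    (hX : ∀ i j (w : PlacesOver E v), Valued.v (((gramS F E v 2 T₀)⁻¹ * ((εu : LocalRing E v) •
      !![toLocalRing E v a, quadraticLocalEquiv E v c hcδ hδ (z₁, z₂); conjLocal E c v (quadraticLocalEquiv E v c hcδ hδ (z₁, z₂)), toLocalRing E v b])) i j w) ≤
      Valued.v (toPlace v w π) ^ m) :
    a ∈ primePowBall (v.adicCompletion F) m ∧ b ∈ primePowBall (v.adicCompletion F) m ∧
      z₁ ∈ primePowBall (v.adicCompletion F) m ∧ z₂ ∈ primePowBall (v.adicCompletion F) m := by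
  have hT : IsUnit (gramS F E v 2 T₀).det := isUnit_det_gramS' F E v 2 hT₀d
  have hTX := mball_mul F E v hπ hTb hX
  -- the entries of `H = ε⁻¹ • (T X)` lie in `ball m`
  have hHb : ∀ i j (w : PlacesOver E v), Valued.v ((!![toLocalRing E v a, quadraticLocalEquiv E v c hcδ hδ (z₁, z₂);
      conjLocal E c v (quadraticLocalEquiv E v c hcδ hδ (z₁, z₂)), toLocalRing E v b] : Matrix (Fin 2) (Fin 2) (LocalRing E v)) i j w) ≤
      Valued.v (toPlace v w π) ^ m := by
    intro i j w
    have key : (!![toLocalRing E v a, quadraticLocalEquiv E v c hcδ hδ (z₁, z₂);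
        conjLocal E c v (quadraticLocalEquiv E v c hcδ hδ (z₁, z₂)), toLocalRing E v b] : Matrix (Fin 2) (Fin 2) (LocalRing E v)) i j =
        (↑εu⁻¹ : LocalRing E v) * (gramS F E v 2 T₀ * ((gramS F E v 2 T₀)⁻¹ * ((εu : LocalRing E v) •
          !![toLocalRing E v a, quadraticLocalEquiv E v c hcδ hδ (z₁, z₂);
            conjLocal E c v (quadraticLocalEquiv E v c hcδ hδ (z₁, z₂)), toLocalRing E v b]))) i j := by
      rw [Matrix.mul_nonsing_inv_cancel_left _ _ hT, Matrix.smul_apply, smul_eq_mul, ← mul_assoc, Units.inv_mul, one_mul]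
    have h1 := ball_mul F E v hπ hεinv (hTX i j) w
    rw [zero_add, zero_add, Pi.mul_apply] at h1
    rw [key, Pi.mul_apply]
    exact h1
  have ha : a ∈ primePowBall (v.adicCompletion F) m := mem_primePowBall_of_ball_toLocalRing F E v hπ (x := a) fun w => hHb 0 0 w
  have hb : b ∈ primePowBall (v.adicCompletion F) m := mem_primePowBall_of_ball_toLocalRing F E v hπ (x := b) fun w => hHb 1 1 w
  have hz := coords_mem_of_ball F E c hcδ hδ hd v hπ hτ hτadd hτs h2F hddv hδw (m := m) (a := z₁) (b := z₂) fun w => hHb 0 1 w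
  exact ⟨ha, hb, hz.1, hz.2⟩

include hd hπ in
/-- **determinant levels in coordinates**: `T⁻¹(ε • H(a, b, z₁, z₂)) ∈ D(m)` (`|det|_w ≤ |ϖ_w|^m` at all `w`) iff `ab − (z₁² − dd z₂²) ∈ 𝔭_v^m`
(`det = det T⁻¹ · ε² · ι(ab − (z₁² − dd z₂²))` ★ E3a `det_coords`, `det T⁻¹, ε` units). [cite: Shimura1997, §13.5] [cite: KudlaRallis1994, §2] -/
theorem det_mball_iff (hT₀d : IsUnit T₀.det)
    (hTb : ∀ i j (w : PlacesOver E v), Valued.v (gramS F E v 2 T₀ i j w) ≤ Valued.v (toPlace v w π) ^ (0 : ℤ))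
    (hTib : ∀ i j (w : PlacesOver E v), Valued.v ((gramS F E v 2 T₀)⁻¹ i j w) ≤ Valued.v (toPlace v w π) ^ (0 : ℤ))
    (εu : (LocalRing E v)ˣ) (hεv : ∀ w : PlacesOver E v, Valued.v ((εu : LocalRing E v) w) = 1) (m : ℤ) (a b z₁ z₂ : v.adicCompletion F) :
    (∀ w : PlacesOver E v, Valued.v (((gramS F E v 2 T₀)⁻¹ * ((εu : LocalRing E v) •
      !![toLocalRing E v a, quadraticLocalEquiv E v c hcδ hδ (z₁, z₂); conjLocal E c v (quadraticLocalEquiv E v c hcδ hδ (z₁, z₂)), toLocalRing E v b])).det w) ≤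
      Valued.v (toPlace v w π) ^ m) ↔
      a * b - (z₁ ^ 2 - (dd : v.adicCompletion F) * z₂ ^ 2) ∈ primePowBall (v.adicCompletion F) m := by
  have hT : IsUnit (gramS F E v 2 T₀).det := isUnit_det_gramS' F E v 2 hT₀d
  have hTi1 : ∀ w : PlacesOver E v, Valued.v ((gramS F E v 2 T₀)⁻¹.det w) = 1 :=
    valued_det_eq_one_of_mul_eq_one F E v hπ hTib hTb (Matrix.nonsing_inv_mul _ hT)
  have hval : ∀ w : PlacesOver E v, Valued.v (((gramS F E v 2 T₀)⁻¹ * ((εu : LocalRing E v) •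
      !![toLocalRing E v a, quadraticLocalEquiv E v c hcδ hδ (z₁, z₂); conjLocal E c v (quadraticLocalEquiv E v c hcδ hδ (z₁, z₂)), toLocalRing E v b])).det w) =
      Valued.v (toLocalRing E v (a * b - (z₁ ^ 2 - (dd : v.adicCompletion F) * z₂ ^ 2)) w) := fun w => by
    rw [det_coords F E c hcδ hδ hd v, Pi.mul_apply, Pi.mul_apply, map_mul, map_mul, hTi1, one_mul, Pi.pow_apply, map_pow, hεv, one_pow, one_mul]
  constructor
  · intro h; exact mem_primePowBall_of_ball_toLocalRing F E v hπ fun w => (hval w).symm.le.trans (h w)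
  · intro h w; exact (hval w).le.trans (ball_toLocalRing_of_mem_primePowBall F E v hπ h w)

include hπ in
omit [Algebra.IsQuadraticExtension F E] in
/-- **the integrand is constant on `B(0)`-cosets**: for `β ∈ M₂(𝒪)`, `h ∈ B(0)` and `ψ` of conductor exponent `0`,
`ψ(−τ tr(β(t + h))) = ψ(−τ tr(β t))` (`τ tr(βh) ∈ 𝒪_v`). [cite: Tate1950, §2.2] [cite: KudlaRallis1994, §2] -/
theorem addChar_neg_tau_trace_add {ψ : AddChar (v.adicCompletion F) Circle} (hdψ : ψ.HasConductorExp 0)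
    (hτ : ∀ r, toLocalRing E v (τ r) = r + conjLocal E c v r) (hτadd : ∀ r s, τ (r + s) = τ r + τ s)
    {β : Matrix (Fin 2) (Fin 2) (LocalRing E v)} (hβ : ∀ i j (w : PlacesOver E v), Valued.v (β i j w) ≤ Valued.v (toPlace v w π) ^ (0 : ℤ))
    (t : Matrix (Fin 2) (Fin 2) (LocalRing E v)) {h : Matrix (Fin 2) (Fin 2) (LocalRing E v)}
    (hh : ∀ i j (w : PlacesOver E v), Valued.v (h i j w) ≤ Valued.v (toPlace v w π) ^ (0 : ℤ)) :
    ((ψ (-τ (Matrix.trace (β * (t + h)))) : Circle) : ℂ) = ((ψ (-τ (Matrix.trace (β * t))) : Circle) : ℂ) := by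
  have hmem : -τ (Matrix.trace (β * h)) ∈ primePowBall (v.adicCompletion F) 0 := by
    refine neg_mem_primePowBall ?_
    have h1 := tau_mem_primePowBall F E c v hπ hτ (ball_trace F E v (mball_mul F E v hπ hβ hh))
    rwa [add_zero] at h1
  rw [Matrix.mul_add, Matrix.trace_add, hτadd, neg_add, AddChar.map_add_eq_mul, hdψ.1 _ hmem, mul_one]


/-! ## §2 The pairing letters of `β`: `ε⁻¹ β T⁻¹ = (ι p, u; σ u, ι r)` with `p r − (u₁² − dd u₂²)` a unit -/

include hd hπ in
/-- **the pairing letters**: for `T`-skew integral `β` and an anti-invariant unit `ε`, `B″ := ε⁻¹ β T⁻¹ = (ι p, u; σ u, ι r)` with `p, r ∈ 𝒪_v`,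
`u = ι u₁ + ι u₂ δ̂`, `u₁, u₂ ∈ 𝒪_v`, and `τ tr(β · T⁻¹(ε • H(a,b,z₁,z₂))) = 2e·(p a + r b + 2(u₁ z₁ − dd u₂ z₂))`, `2e = τ(ε²)` (★ E3a
`tau_trace_coords`). [cite: Shimura1997, §13.5] [cite: KudlaRallis1994, §2] -/
theorem exists_pairing_letters (hT₀ : T₀.IsSymm) (hT₀d : IsUnit T₀.det)
    (hτ : ∀ r, toLocalRing E v (τ r) = r + conjLocal E c v r) (hτadd : ∀ r s, τ (r + s) = τ r + τ s)
    (hτs : ∀ (z : v.adicCompletion F) (r : LocalRing E v), τ (toLocalRing E v z * r) = z * τ r)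
    (h2F : Valued.v (2 : v.adicCompletion F) = 1) (hddv : Valued.v (dd : v.adicCompletion F) = 1)
    (hδw : ∀ w : PlacesOver E v, Valued.v (algebraMap E (LocalRing E v) δ w) ≤ Valued.v (toPlace v w π) ^ (0 : ℤ))
    (hTib : ∀ i j (w : PlacesOver E v), Valued.v ((gramS F E v 2 T₀)⁻¹ i j w) ≤ Valued.v (toPlace v w π) ^ (0 : ℤ))
    (εu : (LocalRing E v)ˣ) (hεσ : conjLocal E c v (εu : LocalRing E v) = -(εu : LocalRing E v))
    (hεinv : ∀ w : PlacesOver E v, Valued.v ((↑εu⁻¹ : LocalRing E v) w) ≤ Valued.v (toPlace v w π) ^ (0 : ℤ))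
    {β : Matrix (Fin 2) (Fin 2) (LocalRing E v)} (hβs : (β.map (conjLocal E c v))ᵀ * gramS F E v 2 T₀ + gramS F E v 2 T₀ * β = 0)
    (hβ : ∀ i j (w : PlacesOver E v), Valued.v (β i j w) ≤ Valued.v (toPlace v w π) ^ (0 : ℤ)) :
    ∃ p r u₁ u₂ : v.adicCompletion F, Valued.v p ≤ 1 ∧ Valued.v r ≤ 1 ∧ Valued.v u₁ ≤ 1 ∧ Valued.v u₂ ≤ 1 ∧
      (↑εu⁻¹ : LocalRing E v) • (β * (gramS F E v 2 T₀)⁻¹) =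
        !![toLocalRing E v p, quadraticLocalEquiv E v c hcδ hδ (u₁, u₂); conjLocal E c v (quadraticLocalEquiv E v c hcδ hδ (u₁, u₂)), toLocalRing E v r] ∧
      ∀ a b z₁ z₂ : v.adicCompletion F, τ (Matrix.trace (β * ((gramS F E v 2 T₀)⁻¹ * ((εu : LocalRing E v) •
          !![toLocalRing E v a, quadraticLocalEquiv E v c hcδ hδ (z₁, z₂); conjLocal E c v (quadraticLocalEquiv E v c hcδ hδ (z₁, z₂)), toLocalRing E v b])))) =
        2 * (2⁻¹ * τ ((εu : LocalRing E v) ^ 2)) * (p * a + r * b + 2 * (u₁ * z₁ - (dd : v.adicCompletion F) * u₂ * z₂)) := by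
  set T := gramS F E v 2 T₀ with hTdef
  have hT : IsUnit T.det := isUnit_det_gramS' F E v 2 hT₀d
  have hTt : Tᵀ = T := gramS_transpose F E v 2 hT₀
  have hTσ : T.map (conjLocal E c v) = T := gramS_map_conj F E c v 2
  have h20 : (2 : v.adicCompletion F) ≠ 0 := fun h0 => by rw [h0, map_zero] at h2F; exact zero_ne_one h2F
  have hfix : ∀ x : LocalRing E v, conjLocal E c v x = x → x = toLocalRing E v (2⁻¹ * τ x) := fun x hx => by
    have h1 : toLocalRing E v (τ x) = 2 * x := by rw [hτ, hx, two_mul]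
    rw [map_mul, h1, ← mul_assoc, show toLocalRing E v 2⁻¹ * 2 = 1 by rw [← map_ofNat (toLocalRing E v) 2, ← map_mul, inv_mul_cancel₀ h20, map_one],
      one_mul]
  have hTiσ : T⁻¹.map (conjLocal E c v) = T⁻¹ := by
    have h1 : T⁻¹.map (conjLocal E c v) * T = 1 := by
      calc T⁻¹.map (conjLocal E c v) * T = T⁻¹.map (conjLocal E c v) * T.map (conjLocal E c v) := by rw [hTσ]
        _ = (T⁻¹ * T).map (conjLocal E c v) := Matrix.map_mul.symm
        _ = 1 := by rw [Matrix.nonsing_inv_mul _ hT, Matrix.map_one _ (map_zero _) (map_one _)]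
    rw [← Matrix.inv_eq_left_inv h1]
  have hσεinv : conjLocal E c v (↑εu⁻¹ : LocalRing E v) = -(↑εu⁻¹ : LocalRing E v) := by
    have h1 : conjLocal E c v (↑εu⁻¹ : LocalRing E v) * (-(εu : LocalRing E v)) = 1 := by
      rw [← hεσ, ← _root_.map_mul, Units.inv_mul, map_one]
    calc conjLocal E c v (↑εu⁻¹ : LocalRing E v)
        = conjLocal E c v (↑εu⁻¹ : LocalRing E v) * (-(εu : LocalRing E v) * -(↑εu⁻¹ : LocalRing E v)) := by
          rw [neg_mul_neg, Units.mul_inv, mul_one]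
      _ = -(↑εu⁻¹ : LocalRing E v) := by rw [← mul_assoc, h1, one_mul]
  set B := (↑εu⁻¹ : LocalRing E v) • (β * T⁻¹) with hBdef
  -- `σ(B) = Bᵀ`
  have hBσ : B.map (conjLocal E c v) = Bᵀ := by
    have hσβ := map_conj_eq_of_skew F E c v hT hTt hβs
    have hsm : ((↑εu⁻¹ : LocalRing E v) • (β * T⁻¹)).map (conjLocal E c v) = conjLocal E c v ↑εu⁻¹ • ((β * T⁻¹).map (conjLocal E c v)) := by
      ext i j; simp only [Matrix.map_apply, Matrix.smul_apply, smul_eq_mul, _root_.map_mul]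
    rw [hBdef, hsm, hσεinv, Matrix.map_mul, hσβ, hTiσ, Matrix.transpose_smul, Matrix.transpose_mul, Matrix.transpose_nonsing_inv, hTt,
      Matrix.neg_mul, Matrix.mul_nonsing_inv_cancel_right _ _ hT, smul_neg, neg_smul, neg_neg]
  have hB10 : B 1 0 = conjLocal E c v (B 0 1) := by
    have h := congrFun (congrFun hBσ 0) 1
    rw [Matrix.map_apply, Matrix.transpose_apply] at h
    exact h.symm
  have hB00 : B 0 0 = toLocalRing E v (2⁻¹ * τ (B 0 0)) := hfix _ (by
    have h := congrFun (congrFun hBσ 0) 0; rwa [Matrix.map_apply, Matrix.transpose_apply] at h)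
  have hB11 : B 1 1 = toLocalRing E v (2⁻¹ * τ (B 1 1)) := hfix _ (by
    have h := congrFun (congrFun hBσ 1) 1; rwa [Matrix.map_apply, Matrix.transpose_apply] at h)
  obtain ⟨⟨u₁, u₂⟩, hu⟩ : ∃ z : v.adicCompletion F × v.adicCompletion F, quadraticLocalEquiv E v c hcδ hδ z = B 0 1 :=
    ⟨_, (quadraticLocalEquiv E v c hcδ hδ).apply_symm_apply _⟩
  -- integrality of `B`
  have hBint : ∀ i j (w : PlacesOver E v), Valued.v (B i j w) ≤ Valued.v (toPlace v w π) ^ (0 : ℤ) := by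
    intro i j w
    rw [hBdef, Matrix.smul_apply, smul_eq_mul]
    have h1 := ball_mul F E v hπ hεinv (mball_mul F E v hπ hβ hTib i j) w
    rwa [zero_add, zero_add] at h1
  have htwo : ∀ x : LocalRing E v, (∀ w : PlacesOver E v, Valued.v (x w) ≤ Valued.v (toPlace v w π) ^ (0 : ℤ)) → Valued.v (2⁻¹ * τ x) ≤ 1 := by
    intro x hx
    have h1 := tau_mem_primePowBall F E c v hπ hτ hx
    rw [mem_primePowBall_adicCompletion_iff, neg_zero, WithZero.exp_zero] at h1
    rw [map_mul, map_inv₀, h2F, inv_one, one_mul]; exact h1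
  have huu := coords_mem_of_ball F E c hcδ hδ hd v hπ hτ hτadd hτs h2F hddv hδw (m := 0) (a := u₁) (b := u₂) (fun w => by rw [hu]; exact hBint 0 1 w)
  rw [mem_primePowBall_adicCompletion_iff, mem_primePowBall_adicCompletion_iff, neg_zero, WithZero.exp_zero] at huu
  refine ⟨2⁻¹ * τ (B 0 0), 2⁻¹ * τ (B 1 1), u₁, u₂, htwo _ (hBint 0 0), htwo _ (hBint 1 1), huu.1, huu.2, ?_, fun a b z₁ z₂ => ?_⟩
  · rw [hu, ← hB10, ← hB00, ← hB11]; exact Matrix.eta_fin_two B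
  · exact tau_trace_coords F E c hcδ hδ hd v hT₀ hT₀d hτ hτadd hτs h2F εu hεσ hβs a b z₁ z₂ u₁ u₂ hu.symm

include hd hπ in
/-- **the pairing is non-degenerate modulo `𝔭`**: with `ε⁻¹ β T⁻¹ = (ι p, u; σ u, ι r)` for unimodular `β`, `T` and a unit `ε`,
`|p r − (u₁² − dd u₂²)|_w = 1` (`det(ι p, u; σ u, ι r) = ι(p r − u σu)`, `= ε⁻² det β det T⁻¹`). [cite: Shimura1997, §13.5] -/
theorem valued_toPlace_pairing_det (hT₀d : IsUnit T₀.det)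
    (hTb : ∀ i j (w : PlacesOver E v), Valued.v (gramS F E v 2 T₀ i j w) ≤ Valued.v (toPlace v w π) ^ (0 : ℤ))
    (hTib : ∀ i j (w : PlacesOver E v), Valued.v ((gramS F E v 2 T₀)⁻¹ i j w) ≤ Valued.v (toPlace v w π) ^ (0 : ℤ))
    (εu : (LocalRing E v)ˣ) (hεv : ∀ w : PlacesOver E v, Valued.v ((εu : LocalRing E v) w) = 1)
    {β βinv : Matrix (Fin 2) (Fin 2) (LocalRing E v)} (hββ : β * βinv = 1)
    (hβ : ∀ i j (w : PlacesOver E v), Valued.v (β i j w) ≤ Valued.v (toPlace v w π) ^ (0 : ℤ))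
    (hβinv : ∀ i j (w : PlacesOver E v), Valued.v (βinv i j w) ≤ Valued.v (toPlace v w π) ^ (0 : ℤ))
    {p r u₁ u₂ : v.adicCompletion F}
    (hB : (↑εu⁻¹ : LocalRing E v) • (β * (gramS F E v 2 T₀)⁻¹) =
      !![toLocalRing E v p, quadraticLocalEquiv E v c hcδ hδ (u₁, u₂); conjLocal E c v (quadraticLocalEquiv E v c hcδ hδ (u₁, u₂)), toLocalRing E v r])
    (w : PlacesOver E v) :
    Valued.v (toPlace v w (p * r - (u₁ ^ 2 - (dd : v.adicCompletion F) * u₂ ^ 2))) = 1 := by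
  have hT : IsUnit (gramS F E v 2 T₀).det := isUnit_det_gramS' F E v 2 hT₀d
  have hR : (!![toLocalRing E v p, quadraticLocalEquiv E v c hcδ hδ (u₁, u₂); conjLocal E c v (quadraticLocalEquiv E v c hcδ hδ (u₁, u₂)), toLocalRing E v r] :
      Matrix (Fin 2) (Fin 2) (LocalRing E v)).det = toLocalRing E v (p * r - (u₁ ^ 2 - (dd : v.adicCompletion F) * u₂ ^ 2)) := by
    rw [Matrix.det_fin_two_of, map_sub, map_mul, ← quadraticLocalEquiv_mul_conjLocal E c hcδ hδ hd v]
  have hdet := congrArg Matrix.det hB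
  rw [Matrix.det_smul, Fintype.card_fin, Matrix.det_mul, hR] at hdet
  have h1 : Valued.v (β.det w) = 1 := valued_det_eq_one_of_mul_eq_one F E v hπ hβ hβinv hββ w
  have h2 : Valued.v ((gramS F E v 2 T₀)⁻¹.det w) = 1 := valued_det_eq_one_of_mul_eq_one F E v hπ hTib hTb (Matrix.nonsing_inv_mul _ hT) w
  have h3 : Valued.v ((↑εu⁻¹ : LocalRing E v) w) = 1 := by
    have h := congrArg (fun x : LocalRing E v => Valued.v (x w)) (Units.inv_mul εu)
    simp only [Pi.mul_apply, map_mul, Pi.one_apply, map_one, hεv, mul_one] at h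
    exact h
  have h := congrArg (fun x : LocalRing E v => Valued.v (x w)) hdet
  simp only [Pi.mul_apply, Pi.pow_apply, map_mul, map_pow, h1, h2, h3, one_pow, one_mul, toLocalRing_apply] at h
  exact h.symm

/-- the coordinate family `X(a, b, z₁, z₂) = T⁻¹(ε • H(a, b, z₁, z₂))` is ADDITIVE in `(a, b, z₁, z₂)`. [cite: Shimura1997, §13.5] -/
theorem coordMatrix_add (ε : LocalRing E v) (a b z₁ z₂ a' b' z₁' z₂' : v.adicCompletion F) :
    (gramS F E v 2 T₀)⁻¹ * (ε • !![toLocalRing E v a, quadraticLocalEquiv E v c hcδ hδ (z₁, z₂);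
        conjLocal E c v (quadraticLocalEquiv E v c hcδ hδ (z₁, z₂)), toLocalRing E v b]) +
      (gramS F E v 2 T₀)⁻¹ * (ε • !![toLocalRing E v a', quadraticLocalEquiv E v c hcδ hδ (z₁', z₂');
        conjLocal E c v (quadraticLocalEquiv E v c hcδ hδ (z₁', z₂')), toLocalRing E v b']) =
      (gramS F E v 2 T₀)⁻¹ * (ε • !![toLocalRing E v (a + a'), quadraticLocalEquiv E v c hcδ hδ (z₁ + z₁', z₂ + z₂');
        conjLocal E c v (quadraticLocalEquiv E v c hcδ hδ (z₁ + z₁', z₂ + z₂')), toLocalRing E v (b + b')]) := by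
  rw [← Matrix.mul_add, ← smul_add, show ((z₁ + z₁', z₂ + z₂') : v.adicCompletion F × v.adicCompletion F) = (z₁, z₂) + (z₁', z₂') from rfl]
  simp only [map_add]
  congr 2
  ext i j; fin_cases i <;> fin_cases j <;> rfl

/-- … and compatible with negation. [cite: Shimura1997, §13.5] -/
theorem coordMatrix_neg (ε : LocalRing E v) (a b z₁ z₂ : v.adicCompletion F) :
    -((gramS F E v 2 T₀)⁻¹ * (ε • !![toLocalRing E v a, quadraticLocalEquiv E v c hcδ hδ (z₁, z₂);
        conjLocal E c v (quadraticLocalEquiv E v c hcδ hδ (z₁, z₂)), toLocalRing E v b])) =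
      (gramS F E v 2 T₀)⁻¹ * (ε • !![toLocalRing E v (-a), quadraticLocalEquiv E v c hcδ hδ (-z₁, -z₂);
        conjLocal E c v (quadraticLocalEquiv E v c hcδ hδ (-z₁, -z₂)), toLocalRing E v (-b)]) := by
  rw [← Matrix.mul_neg, ← smul_neg, show ((-z₁, -z₂) : v.adicCompletion F × v.adicCompletion F) = -(z₁, z₂) from rfl]
  simp only [map_neg]
  congr 2
  ext i j; fin_cases i <;> fin_cases j <;> rfl

end Summit.HodgeConjecture.HodgeConjecture.Cruxes.HLiu418.K2LiuSkewLatticeHermitianCoordinates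

end
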